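import Literature.AlgebraicGeometry.Resolution.AlterationsPurelyInseparable
import Literature.AlgebraicGeometry.Resolution.AlterationsResolution
import Literature.AlgebraicGeometry.Resolution.BirationalFlattening
import Mathlib.AlgebraicGeometry.Morphisms.Proper
import Mathlib.AlgebraicGeometry.Morphisms.Finite
import Mathlib.AlgebraicGeometry.Morphisms.UniversallyInjective
import HarnessLib

/-!
# `Pialt` (crux stmt-ResolutionOfSingularities-0555), line `SketchIdeator2`, Card B structure

Stubs `stub_piRegModel_of_pialtShape` (B3) and `stub_pialtShape_of_split_data` (B1b) of the
lead's skeleton `indeterminacy-split` (helper file,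
`--supports stmt-ResolutionOfSingularities-0555`; does not close the item).

Card B cuts the crux `Pialt` — every integral variety `X` has a proper `g : X' → X` with `X'`
integral and regular, `g` surjective, finite and universally injective over a dense open — at a
proper `X` into "Frobenius indeterminacy" and "regular purely inseparable model".

* `stub_piRegModel_of_pialtShape` ("forget the morphism"): from the crux data `g : X' → X` at a
  proper `X` over `k`, the regular purely inseparable MODEL is `Y := X'` with structure morphism
  `g ≫ f`, `V := g ⁻¹ᵁ U`, `ψ := g ∣_ U` (finite, universally injective, surjective as a
  restriction of the surjective `g`), and `V.ι ≫ g ≫ f = (g ∣_ U) ≫ U.ι ≫ f` is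
  `morphismRestrict_ι`.
* `stub_pialtShape_of_split_data` (the assembly): in the split situation — `ψ : V → U` a finite
  universally injective surjection from an open of the proper integral `Y` onto a non-empty open
  of `X`, `g : Y' → Y` proper surjective from an integral regular `Y'`, finite and universally
  injective over a dense open `V'`, and `ψ' : Y' → X` over `k` agreeing with `(g ∣_ V) ≫ ψ` on
  `g ⁻¹ᵁ V`, such that no proper closed subset of `Y'` maps onto `X` (the dimension count,
  stub `stub_image_ne_univ_of_isClosed`) — the witness is `X' := Y'` with the morphism `ψ'`:
  - `ψ'` is proper (`ψ' ≫ f = g ≫ h` is proper and `f` is separated, `IsProper.of_comp`);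
  - `ψ'` is surjective: it is a closed map whose image contains the dense open `U`;
  - with `C := (g ⁻¹ᵁ (V ⊓ V'))ᶜ`, a closed subset `≠ Y'`, the open `U₂ := (X ∖ ψ'(C)) ⊓ U` is
    non-empty, hence dense, `ψ' ⁻¹ᵁ U₂ ⊆ g ⁻¹ᵁ (V ⊓ V')`, and over `U₂` the morphism `ψ'` is
    (up to the isomorphism `(g ⁻¹ᵁ V).ι ∣_ (ψ' ⁻¹ᵁ U₂)`) the restriction of the composite
    `(g ∣_ V) ≫ ψ ≫ U.ι`, whose three factors restrict over `U₂` to: `g` over an open `≤ V'`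
    (finite, universally injective), a restriction of `ψ` (finite, universally injective), and an
    isomorphism (`isIso_ι_morphismRestrict_of_le` of `BirationalFlattening.lean`).

All statements are elementary scheme theory (Stacks, Tags 01S2/01S4: universally injective
morphisms are stable under base change and composition; 01W6: cancellation of properness;
01WM: finite morphisms). No named facts are used.
-/

set_option linter.dupNamespace false -- mandated namespace of this single-conjunct summit

noncomputable section

open CategoryTheory CategoryTheory.Limits AlgebraicGeometry TopologicalSpace
open Literature.AlgebraicGeometry.Resolution

namespace Summit.ResolutionOfSingularities.ResolutionOfSingularities.Theorems.Pialt.IndeterminacySplit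

/-- **Card B, "forget the morphism"** (stub `stub_piRegModel_of_pialtShape` of the line
`SketchIdeator2` / Card B `indeterminacy-split`). If the proper integral `k`-variety `X` has a
proper `g : X' → X` with `X'` integral and regular, `g` surjective, and `g` finite and universally
injective over a dense open `U ⊆ X`, then `X` has a regular purely inseparable model: `Y := X'`
over `k` via `g ≫ f`, with the finite universally injective surjection
`ψ := g ∣_ U : g ⁻¹ᵁ U → U` (surjectivity is Zariski-local on the target) and the compatibility
`(g ⁻¹ᵁ U).ι ≫ g ≫ f = (g ∣_ U) ≫ U.ι ≫ f` (`morphismRestrict_ι`); `U` is non-empty because a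
dense subset of the non-empty `X` is. [folklore] -/
theorem stub_piRegModel_of_pialtShape (k : Type) [Field k] (X : Scheme.{0})
    (f : X ⟶ Spec (.of k)) [IsProper f] [IsIntegral X]
    (h : ∃ (X' : Scheme.{0}) (g : X' ⟶ X), IsProper g ∧ IsIntegral X' ∧ Scheme.IsRegular X' ∧
      Function.Surjective g.base ∧ ∃ U : X.Opens, Dense (U : Set X) ∧ IsFinite (g ∣_ U) ∧
        UniversallyInjective (g ∣_ U)) :
    ∃ (Y : Scheme.{0}) (h : Y ⟶ Spec (.of k)), IsProper h ∧ IsIntegral Y ∧ Scheme.IsRegular Y ∧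
      ∃ (U : X.Opens) (V : Y.Opens) (ψ : (V : Scheme.{0}) ⟶ (U : Scheme.{0})),
        (U : Set X).Nonempty ∧ IsFinite ψ ∧ UniversallyInjective ψ ∧
          Function.Surjective ψ.base ∧ V.ι ≫ h = ψ ≫ U.ι ≫ f := by
  obtain ⟨X', g, hg, hint, hreg, hsurj, U, hU, hfin, hui⟩ := h
  haveI := hg
  refine ⟨X', g ≫ f, inferInstance, hint, hreg, U, g ⁻¹ᵁ U, g ∣_ U, hU.nonempty, hfin, hui,
    ?_, ?_⟩
  · haveI : Surjective g := ⟨hsurj⟩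
    exact (IsZariskiLocalAtTarget.restrict (P := @Surjective) inferInstance U).1
  · rw [← morphismRestrict_ι_assoc]

/-- **Card B, assembly of the split** (stub `stub_pialtShape_of_split_data` of the line
`SketchIdeator2` / Card B `indeterminacy-split`). In the split situation — `X`, `Y` proper and
integral over `k`; `ψ : V → U` finite, universally injective and surjective from an open of `Y`
onto a non-empty open of `X`, over `k`; `g : Y' → Y` proper surjective from an integral regular
`Y'`, finite and universally injective over a dense open `V' ⊆ Y`; `ψ' : Y' → X` over `k` with
`(g ⁻¹ᵁ V).ι ≫ ψ' = (g ∣_ V) ≫ ψ ≫ U.ι`; and no proper closed subset of `Y'` mapping onto `X`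
under `ψ'` — the morphism `ψ' : Y' → X` is the sought regular purely inseparable alteration:
it is proper (`ψ' ≫ f = g ≫ h` proper, `f` separated), surjective (closed image containing the
dense open `U`), and finite universally injective over the dense open
`U₂ := (X ∖ ψ'((g ⁻¹ᵁ (V ⊓ V'))ᶜ)) ⊓ U`, over which it is, up to an isomorphism of open
subschemes of `Y'`, the restriction of `(g ∣_ V) ≫ ψ ≫ U.ι` — there `g` lives over an open
`≤ V'`, `ψ` is restricted to an open of `U`, and `U.ι` restricts to an isomorphism. [folklore] -/
theorem stub_pialtShape_of_split_data (k : Type) [Field k] (X : Scheme.{0})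
    (f : X ⟶ Spec (.of k)) [IsProper f] [IsIntegral X] (Y : Scheme.{0})
    (h : Y ⟶ Spec (.of k)) [IsProper h] [IsIntegral Y] (U : X.Opens) (V : Y.Opens)
    (ψ : (V : Scheme.{0}) ⟶ (U : Scheme.{0})) (hU : (U : Set X).Nonempty) [IsFinite ψ]
    [UniversallyInjective ψ] (hψs : Function.Surjective ψ.base)
    (hcomm : V.ι ≫ h = ψ ≫ U.ι ≫ f) (Y' : Scheme.{0}) [IsIntegral Y'] (g : Y' ⟶ Y)
    [IsProper g] (hgs : Function.Surjective g.base) (V' : Y.Opens) (hV' : Dense (V' : Set Y))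
    [IsFinite (g ∣_ V')] [UniversallyInjective (g ∣_ V')] (ψ' : Y' ⟶ X)
    (hψ' : ψ' ≫ f = g ≫ h) (hreg : Scheme.IsRegular Y')
    (hcompat : (g ⁻¹ᵁ V).ι ≫ ψ' = (g ∣_ V) ≫ ψ ≫ U.ι)
    (hC : ∀ C : Set Y', IsClosed C → C ≠ Set.univ → ψ'.base '' C ≠ Set.univ) :
    ∃ (X' : Scheme.{0}) (g : X' ⟶ X), IsProper g ∧ IsIntegral X' ∧ Scheme.IsRegular X' ∧
      Function.Surjective g.base ∧ ∃ U : X.Opens, Dense (U : Set X) ∧ IsFinite (g ∣_ U) ∧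
        UniversallyInjective (g ∣_ U) := by
  have _ := hcomm
  -- (1) `ψ'` is proper: `ψ' ≫ f = g ≫ h` is proper and `f` is separated
  haveI : IsProper (ψ' ≫ f) := by
    rw [hψ']
    infer_instance
  haveI hprop : IsProper ψ' := IsProper.of_comp ψ' f
  -- the formula for `ψ'` on `g ⁻¹ᵁ V`
  have hval : ∀ (y : Y') (hy : y ∈ g ⁻¹ᵁ V), ψ'.base y = (ψ.base ⟨g.base y, hy⟩).1 := by
    intro y hy
    have h1 : ((g ⁻¹ᵁ V).ι ≫ ψ') ⟨y, hy⟩ = ((g ∣_ V) ≫ ψ ≫ U.ι) ⟨y, hy⟩ := by rw [hcompat]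
    have h2 : (g ∣_ V) ⟨y, hy⟩ = ⟨g y, hy⟩ := Subtype.ext (morphismRestrict_base_coe g V ⟨y, hy⟩)
    simp only [Scheme.Hom.comp_apply, Scheme.Opens.ι_apply, h2] at h1
    exact h1
  -- (2) `ψ'` is surjective: a closed map whose image contains the dense open `U`
  have hsurj : Function.Surjective ψ'.base := by
    have hcl : IsClosed (Set.range ψ'.base) := ψ'.isClosedMap.isClosed_range
    have hUsub : (U : Set X) ⊆ Set.range ψ'.base := by
      intro x hx
      obtain ⟨v, hv⟩ := hψs ⟨x, hx⟩
      obtain ⟨y, hy⟩ := hgs v.1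
      have hyV : y ∈ g ⁻¹ᵁ V := by
        show g.base y ∈ V
        rw [hy]
        exact v.2
      refine ⟨y, ?_⟩
      rw [hval y hyV]
      have : (⟨g.base y, hyV⟩ : V) = v := Subtype.ext hy
      rw [this, hv]
    have hUd : Dense (U : Set X) := U.isOpen.dense hU
    rw [← Set.range_eq_univ, ← (hUd.mono hUsub).closure_eq, hcl.closure_eq]
  -- (3) the dense open: `V₀ := V ⊓ V'`, `C := (g ⁻¹ᵁ V₀)ᶜ`, `U₁ := X ∖ ψ'(C)`, `U₂ := U₁ ⊓ U`
  have hVne : (V : Set Y).Nonempty := by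
    obtain ⟨x, hx⟩ := hU
    obtain ⟨v, -⟩ := hψs ⟨x, hx⟩
    exact ⟨v.1, v.2⟩
  set V₀ : Y.Opens := V ⊓ V' with hV₀
  have hV₀ne : (V₀ : Set Y).Nonempty := by
    rw [hV₀, Opens.coe_inf]
    exact hV'.inter_open_nonempty V V.isOpen hVne
  set C : Set Y' := ((g ⁻¹ᵁ V₀ : Y'.Opens) : Set Y')ᶜ
  have hCc : IsClosed C := (g ⁻¹ᵁ V₀).isOpen.isClosed_compl
  have hCne : C ≠ Set.univ := by
    obtain ⟨v, hv⟩ := hV₀ne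
    obtain ⟨y, hy⟩ := hgs v
    intro hC'
    have hyC : y ∈ C := hC' ▸ Set.mem_univ y
    exact hyC (show g.base y ∈ V₀ by rw [hy]; exact hv)
  have himg : IsClosed (ψ'.base '' C) := ψ'.isClosedMap C hCc
  set U₁ : X.Opens := ⟨(ψ'.base '' C)ᶜ, himg.isOpen_compl⟩
  have hU₁ne : (U₁ : Set X).Nonempty := Set.nonempty_compl.mpr (hC C hCc hCne)
  set U₂ : X.Opens := U₁ ⊓ U with hU₂
  have hU₂ne : (U₂ : Set X).Nonempty := by
    rw [hU₂, Opens.coe_inf]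
    exact nonempty_preirreducible_inter U₁.isOpen U.isOpen hU₁ne hU
  have hU₂d : Dense (U₂ : Set X) := U₂.isOpen.dense hU₂ne
  -- points of `ψ' ⁻¹ᵁ U₂` lie in `g ⁻¹ᵁ V₀`
  have hpre : ∀ y : Y', ψ'.base y ∈ U₂ → y ∈ g ⁻¹ᵁ V₀ := by
    intro y hy
    by_contra hyC
    exact hy.1 ⟨y, hyC, rfl⟩
  refine ⟨Y', ψ', hprop, inferInstance, hreg, hsurj, U₂, hU₂d, ?_⟩
  -- (a) the open immersion `(g ⁻¹ᵁ V).ι ∣_ (ψ' ⁻¹ᵁ U₂)` is an isomorphism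
  haveI hiso : IsIso ((g ⁻¹ᵁ V).ι ∣_ (ψ' ⁻¹ᵁ U₂)) :=
    isIso_ι_morphismRestrict_of_le fun y hy => (hpre y hy).1
  -- (b) `(g ∣_ V) ∣_ ((ψ ≫ U.ι) ⁻¹ᵁ U₂)` is finite and universally injective: up to
  -- `morphismRestrictRestrict` it is `g` over an open `≤ V'`
  have hle : V.ι ''ᵁ ((ψ ≫ U.ι) ⁻¹ᵁ U₂) ≤ V' := by
    rintro _ ⟨v, hv, rfl⟩
    obtain ⟨y, hy⟩ := hgs v.1
    have hyV : y ∈ g ⁻¹ᵁ V := by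
      show g.base y ∈ V
      rw [hy]
      exact v.2
    have h1 : ψ'.base y = (ψ.base v).1 := by
      rw [hval y hyV]
      have : (⟨g.base y, hyV⟩ : V) = v := Subtype.ext hy
      rw [this]
    have h2 : ψ'.base y ∈ U₂ := by
      rw [h1]
      exact hv
    have h3 : g.base y ∈ V' := (hpre y h2).2
    rwa [hy] at h3
  have hfin1 : IsFinite ((g ∣_ V) ∣_ ((ψ ≫ U.ι) ⁻¹ᵁ U₂)) :=
    haveI := isFinite_morphismRestrict_of_le g hle
    (MorphismProperty.arrow_mk_iso_iff @IsFinite (morphismRestrictRestrict g V _)).mpr this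
  have hui1 : UniversallyInjective ((g ∣_ V) ∣_ ((ψ ≫ U.ι) ⁻¹ᵁ U₂)) :=
    haveI := universallyInjective_morphismRestrict_of_le g hle
    (MorphismProperty.arrow_mk_iso_iff @UniversallyInjective
      (morphismRestrictRestrict g V _)).mpr this
  -- (c) `ψ ∣_ (U.ι ⁻¹ᵁ U₂)` is finite and universally injective; `U.ι ∣_ U₂` is an isomorphism
  have hui2 : UniversallyInjective (ψ ∣_ (U.ι ⁻¹ᵁ U₂)) := IsZariskiLocalAtTarget.restrict ‹_› _
  haveI hiso3 : IsIso (U.ι ∣_ U₂) := isIso_ι_morphismRestrict_of_le inf_le_right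
  -- (d) hence `((g ∣_ V) ≫ ψ ≫ U.ι) ∣_ U₂` is finite and universally injective
  have hfinφ : IsFinite (((g ∣_ V) ≫ ψ ≫ U.ι) ∣_ U₂) := by
    rw [morphismRestrict_comp, morphismRestrict_comp]
    exact MorphismProperty.comp_mem _ _ _ hfin1
      (MorphismProperty.comp_mem _ _ _ inferInstance inferInstance)
  have huiφ : UniversallyInjective (((g ∣_ V) ≫ ψ ≫ U.ι) ∣_ U₂) := by
    rw [morphismRestrict_comp, morphismRestrict_comp]
    exact MorphismProperty.comp_mem _ _ _ hui1
      (MorphismProperty.comp_mem _ _ _ hui2 inferInstance)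
  -- (e) transfer to `ψ'` along `hcompat` and the isomorphism of (a)
  have hcompφ : ((g ⁻¹ᵁ V).ι ≫ ψ') ∣_ U₂ = ((g ⁻¹ᵁ V).ι ∣_ (ψ' ⁻¹ᵁ U₂)) ≫ (ψ' ∣_ U₂) :=
    morphismRestrict_comp _ _ _
  constructor
  · have h1 : IsFinite (((g ⁻¹ᵁ V).ι ≫ ψ') ∣_ U₂) := by
      rw [hcompat]
      exact hfinφ
    have h2 : IsFinite (((g ⁻¹ᵁ V).ι ∣_ (ψ' ⁻¹ᵁ U₂)) ≫ (ψ' ∣_ U₂)) := by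
      rw [← hcompφ]
      exact h1
    exact (MorphismProperty.cancel_left_of_respectsIso @IsFinite _ _).mp h2
  · have h1 : UniversallyInjective (((g ⁻¹ᵁ V).ι ≫ ψ') ∣_ U₂) := by
      rw [hcompat]
      exact huiφ
    have h2 : UniversallyInjective (((g ⁻¹ᵁ V).ι ∣_ (ψ' ⁻¹ᵁ U₂)) ≫ (ψ' ∣_ U₂)) := by
      rw [← hcompφ]
      exact h1
    exact (MorphismProperty.cancel_left_of_respectsIso @UniversallyInjective _ _).mp h2

end Summit.ResolutionOfSingularities.ResolutionOfSingularities.Theorems.Pialt.IndeterminacySplit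

end
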